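import Literature.Probability.FitznerVanDerHofstad2017.EigenTails
import HarnessLib

/-!
# The eigen-tail leaf, CONVERGENCE side: superharmonic (Collatz–Wielandt) certificates for `ρ(B) < 1` and geometric tail bounds

CITATION HEADER (PLACEMENT v2). Part of the certified REPRODUCTION of R. Fitzner, R. van der Hofstad, *Mean-field
behavior for nearest-neighbor percolation in `d > 10`*, EJP 22 (2017) no. 43 [FvdH17] (notebook `Percolation.nb`:
the `Eigensystem` cell l.640–653 and the `EvenTail` / `OddTail` cells l.841–844, 860–869); build `lace`, seat lean1
(gen 6).  ADDITIVE companion of `EigenTails.lean` (nothing there is changed).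

`EigenTails.lean` proves the DIVERGENCE certificate used by the `d = 10` no-go frame: `0 ≤ B`, `v ≤ B v` entrywise,
`v_{i₀} > 0` ⇒ `B ∉ NeumannDom` (`not_neumannDom_of_subharmonic`; "a float eigenvalue is not a certificate, an
interval-verified vector inequality `B v ≥ v` is").  This module proves the mirror image, which is what a CLOSING tuple
needs (`NoGoFrame.Frame.Closes.stage1 : y ∈ U`, and any kernel UPPER bound on the `N ≥ 4` tails):

* `pow_mulVec_le_of_superharmonic` — `0 ≤ B`, `0 ≤ r`, `B v ≤ r v` entrywise ⇒ `B^k v ≤ r^k v` for all `k`;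
  `dotProduct_pow_mulVec_le_of_superharmonic`, `pow_mulVec_le_of_le_smul` — the same read through a non-negative
  covector `u` and for a vector `w ≤ c v`, so that a tail term `φ · uᵀ B^k w` is bounded termwise by a geometric sequence;
* `tsum_pow_mulVec_le_of_superharmonic` — for `r < 1` the orbit series converges and `Σ_k (B^k v)_i ≤ v_i/(1 − r)`;
* `neumannDom_of_superharmonic` — the COLLATZ–WIELANDT CONVERGENCE CERTIFICATE: `0 ≤ B`, `v > 0` entrywise, `B v ≤ r v`
  with `r < 1` ⇒ `B ∈ NeumannDom` (in spectral terms `ρ(B) ≤ max_i (Bv)_i/v_i ≤ r < 1`, [DingZhou2009, Thm. 2.7 and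
  Thm. 1.2]; proved here by geometric comparison, no spectral theory), with the entrywise bound
  `Σ_k (B^k)_{ij} ≤ v_i/((1 − r) v_j)` (`tsum_pow_apply_le_of_superharmonic`) and the row-sum / column-sum special cases
  `neumannDom_of_rowSum_le`, `neumannDom_of_colSum_le` (`v = (1,…,1)`).

So an interval-verified `B v ≤ r v`, `r < 1` (e.g. with `v` a float Perron vector rounded outward) is an exact
certificate that a state lies INSIDE the validity region of the eigen cells, and it converts the notebook's closed
forms `e^p/(1 − e^2)` in the eigenvalues into kernel inequalities.  Nothing here is specific to a dimension; no numeral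
of the notebooks occurs; no consumer in the tree today (intended consumers: a printed-bounds stage-1 instance whose `U`
is `NeumannDom (B_s²) ∧ NeumannDom (B̄_s²)`, HOME/GAPS.md G8 (L1′) / G19).

## References

* [DingZhou2009] J. Ding, A. Zhou, Nonnegative Matrices, Positive Operators, and Applications (World Scientific 2009):
  §1.2 Thm. 1.2 (PDF p. 14: for `A ≥ 0`, `(I − A)^{-1} = Σ A^k ≥ 0` exists iff `r(A) < 1`); §2.x Thm. 2.7 (PDF p. 33:
  `min_i (Ax)_i/x_i ≤ r(A) ≤ max_i (Ax)_i/x_i` for every positive `x`); Exercises 2.9–2.15 (PDF p. 47, the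
  Collatz–Wielandt function).
* [FvdH17] notebook Percolation.nb l.640–653, 841–844, 860–869 (the eigen tails these certificates are meant for).
-/

namespace Literature.Probability.FitznerVanDerHofstad2017.EigenTails

open Matrix Finset

section Superharmonic

variable {n : Type*} [Fintype n] [DecidableEq n]

omit [DecidableEq n] in
/-- The `i`-th entry of `M v` as a finite sum (definitional). [folklore] -/
theorem mulVec_apply_eq_sum (M : Matrix n n ℝ) (v : n → ℝ) (i : n) : (M *ᵥ v) i = ∑ l, M i l * v l := rfl

/-- Along a SUPERharmonic vector — `0 ≤ B`, `0 ≤ r` and `B v ≤ r v` entrywise — one has `B^k v ≤ r^k v` entrywise for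
every `k` (the convergence twin of `le_pow_mulVec`). [folklore] -/
theorem pow_mulVec_le_of_superharmonic {B : Matrix n n ℝ} (hB : ∀ i j, 0 ≤ B i j) {v : n → ℝ} {r : ℝ}
    (hr : 0 ≤ r) (hv : ∀ i, (B *ᵥ v) i ≤ r * v i) : ∀ (k : ℕ) (i : n), (B ^ k *ᵥ v) i ≤ r ^ k * v i := by
  intro k
  induction k with
  | zero => intro i; simp
  | succ k ih =>
    intro i
    rw [pow_succ, ← Matrix.mulVec_mulVec]
    calc (B ^ k *ᵥ (B *ᵥ v)) i = ∑ l, (B ^ k) i l * (B *ᵥ v) l := mulVec_apply_eq_sum _ _ _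
      _ ≤ ∑ l, (B ^ k) i l * (r * v l) :=
          Finset.sum_le_sum fun l _ => mul_le_mul_of_nonneg_left (hv l) (pow_apply_nonneg hB k i l)
      _ = r * (B ^ k *ᵥ v) i := by
          rw [mulVec_apply_eq_sum, Finset.mul_sum]
          exact Finset.sum_congr rfl fun l _ => by ring
      _ ≤ r * (r ^ k * v i) := mul_le_mul_of_nonneg_left (ih i) hr
      _ = r ^ (k + 1) * v i := by ring

/-- The same bound read through a non-negative covector: `uᵀ B^k v ≤ r^k · uᵀ v`. [folklore] -/
theorem dotProduct_pow_mulVec_le_of_superharmonic {B : Matrix n n ℝ} (hB : ∀ i j, 0 ≤ B i j) {u v : n → ℝ}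
    (hu : ∀ i, 0 ≤ u i) {r : ℝ} (hr : 0 ≤ r) (hv : ∀ i, (B *ᵥ v) i ≤ r * v i) (k : ℕ) :
    u ⬝ᵥ (B ^ k *ᵥ v) ≤ r ^ k * (u ⬝ᵥ v) := by
  simp only [dotProduct]
  calc ∑ i, u i * (B ^ k *ᵥ v) i ≤ ∑ i, u i * (r ^ k * v i) :=
        Finset.sum_le_sum fun i _ => mul_le_mul_of_nonneg_left (pow_mulVec_le_of_superharmonic hB hr hv k i) (hu i)
    _ = r ^ k * ∑ i, u i * v i := by
        rw [Finset.mul_sum]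
        exact Finset.sum_congr rfl fun i _ => by ring

/-- Domination transfer: for `0 ≤ w ≤ c v` entrywise (`0 ≤ c`), `B^k w ≤ c r^k v` entrywise. [folklore] -/
theorem pow_mulVec_le_of_le_smul {B : Matrix n n ℝ} (hB : ∀ i j, 0 ≤ B i j) {v w : n → ℝ} {c r : ℝ}
    (hw : ∀ i, 0 ≤ w i) (hwv : ∀ i, w i ≤ c * v i) (hc : 0 ≤ c) (hr : 0 ≤ r)
    (hv : ∀ i, (B *ᵥ v) i ≤ r * v i) (k : ℕ) (i : n) : (B ^ k *ᵥ w) i ≤ c * r ^ k * v i := by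
  calc (B ^ k *ᵥ w) i ≤ (B ^ k *ᵥ (c • v)) i :=
        mulVec_mono (pow_apply_nonneg hB k) hw (fun _ _ => le_rfl) (fun j => by simpa using hwv j) i
    _ = c * (B ^ k *ᵥ v) i := by rw [Matrix.mulVec_smul]; simp
    _ ≤ c * (r ^ k * v i) := mul_le_mul_of_nonneg_left (pow_mulVec_le_of_superharmonic hB hr hv k i) hc
    _ = c * r ^ k * v i := by ring

/-- SUMMABILITY AND THE GEOMETRIC BOUND: for `0 ≤ B`, `0 ≤ v`, `B v ≤ r v` with `0 ≤ r < 1`, the orbit series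
`Σ_k (B^k v)_i` converges and is at most `v_i/(1 − r)`. [folklore] -/
theorem tsum_pow_mulVec_le_of_superharmonic {B : Matrix n n ℝ} (hB : ∀ i j, 0 ≤ B i j) {v : n → ℝ}
    (hv0 : ∀ i, 0 ≤ v i) {r : ℝ} (hr0 : 0 ≤ r) (hr1 : r < 1) (hv : ∀ i, (B *ᵥ v) i ≤ r * v i) (i : n) :
    Summable (fun k => (B ^ k *ᵥ v) i) ∧ ∑' k, (B ^ k *ᵥ v) i ≤ v i / (1 - r) := by
  have hgeo : HasSum (fun k : ℕ => r ^ k * v i) ((1 - r)⁻¹ * v i) :=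
    (hasSum_geometric_of_lt_one hr0 hr1).mul_right (v i)
  have h0 : ∀ k, 0 ≤ (B ^ k *ᵥ v) i := fun k => mulVec_nonneg (pow_apply_nonneg hB k) hv0 i
  have hle : ∀ k, (B ^ k *ᵥ v) i ≤ r ^ k * v i := fun k => pow_mulVec_le_of_superharmonic hB hr0 hv k i
  have hs : Summable (fun k => (B ^ k *ᵥ v) i) := Summable.of_nonneg_of_le h0 hle hgeo.summable
  refine ⟨hs, ?_⟩
  calc ∑' k, (B ^ k *ᵥ v) i ≤ ∑' k, r ^ k * v i := hs.tsum_le_tsum hle hgeo.summable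
    _ = (1 - r)⁻¹ * v i := hgeo.tsum_eq
    _ = v i / (1 - r) := by rw [div_eq_inv_mul]

/-- One entry against the orbit: `(B^k)_{ij} v_j ≤ (B^k v)_i` for `0 ≤ B`, `0 ≤ v`. [folklore] -/
theorem pow_apply_mul_le_pow_mulVec {B : Matrix n n ℝ} (hB : ∀ i j, 0 ≤ B i j) {v : n → ℝ}
    (hv0 : ∀ i, 0 ≤ v i) (k : ℕ) (i j : n) : (B ^ k) i j * v j ≤ (B ^ k *ᵥ v) i := by
  rw [mulVec_apply_eq_sum]
  exact Finset.single_le_sum (f := fun l => (B ^ k) i l * v l)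
    (fun l _ => mul_nonneg (pow_apply_nonneg hB k i l) (hv0 l)) (Finset.mem_univ j)

/-- Entrywise geometric domination along a positive superharmonic vector: `(B^k)_{ij} ≤ r^k v_i/v_j`. [folklore] -/
theorem pow_apply_le_of_superharmonic {B : Matrix n n ℝ} (hB : ∀ i j, 0 ≤ B i j) {v : n → ℝ}
    (hvpos : ∀ i, 0 < v i) {r : ℝ} (hr0 : 0 ≤ r) (hv : ∀ i, (B *ᵥ v) i ≤ r * v i) (k : ℕ) (i j : n) :
    (B ^ k) i j ≤ r ^ k * (v i / v j) := by
  rw [mul_div_assoc', le_div_iff₀ (hvpos j)]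
  exact (pow_apply_mul_le_pow_mulVec hB (fun l => (hvpos l).le) k i j).trans
    (pow_mulVec_le_of_superharmonic hB hr0 hv k i)

omit [DecidableEq n] in
/-- If `0 ≤ B`, `v > 0` entrywise and `B v ≤ r v`, then `0 ≤ r` (unless the index type is empty, in which case every
statement below is vacuous; we read it off at a given index). [folklore] -/
theorem ratio_nonneg_of_superharmonic {B : Matrix n n ℝ} (hB : ∀ i j, 0 ≤ B i j) {v : n → ℝ}
    (hvpos : ∀ i, 0 < v i) {r : ℝ} (hv : ∀ i, (B *ᵥ v) i ≤ r * v i) (i : n) : 0 ≤ r := by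
  have h2 : 0 * v i ≤ r * v i := by
    rw [zero_mul]
    exact (mulVec_nonneg hB (fun l => (hvpos l).le) i).trans (hv i)
  exact le_of_mul_le_mul_right h2 (hvpos i)

/-- COLLATZ–WIELANDT CONVERGENCE CERTIFICATE.  If `0 ≤ B` entrywise and a vector `v` with all entries POSITIVE satisfies
`B v ≤ r v` entrywise for some `r < 1`, then `B ∈ NeumannDom` (every entry series `Σ_k (B^k)_{ij}` converges; in spectral
terms `ρ(B) ≤ max_i (Bv)_i/v_i ≤ r < 1`).  An interval-verified `B v ≤ r v` is therefore an exact certificate that a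
state lies INSIDE the validity region of the eigen cells — the mirror image of `not_neumannDom_of_subharmonic`.
[cite: DingZhou2009, Theorem 2.7 (PDF p. 33) and §1.2 Theorem 1.2 (PDF p. 14)] -/
theorem neumannDom_of_superharmonic {B : Matrix n n ℝ} (hB : ∀ i j, 0 ≤ B i j) {v : n → ℝ}
    (hvpos : ∀ i, 0 < v i) {r : ℝ} (hr1 : r < 1) (hv : ∀ i, (B *ᵥ v) i ≤ r * v i) : NeumannDom B := by
  intro i j
  have hr0 : 0 ≤ r := ratio_nonneg_of_superharmonic hB hvpos hv i
  exact Summable.of_nonneg_of_le (fun k => pow_apply_nonneg hB k i j)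
    (fun k => pow_apply_le_of_superharmonic hB hvpos hr0 hv k i j)
    ((summable_geometric_of_lt_one hr0 hr1).mul_right (v i / v j))

/-- The quantitative form: `Σ_k (B^k)_{ij} ≤ v_i/((1 − r) v_j)` under the hypotheses of `neumannDom_of_superharmonic`.
[cite: DingZhou2009, Theorem 2.7 (PDF p. 33) and §1.2 Theorem 1.2 (PDF p. 14)] -/
theorem tsum_pow_apply_le_of_superharmonic {B : Matrix n n ℝ} (hB : ∀ i j, 0 ≤ B i j) {v : n → ℝ}
    (hvpos : ∀ i, 0 < v i) {r : ℝ} (hr1 : r < 1) (hv : ∀ i, (B *ᵥ v) i ≤ r * v i) (i j : n) :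
    ∑' k, (B ^ k) i j ≤ v i / ((1 - r) * v j) := by
  have hr0 : 0 ≤ r := ratio_nonneg_of_superharmonic hB hvpos hv i
  have hgeo : HasSum (fun k : ℕ => r ^ k * (v i / v j)) ((1 - r)⁻¹ * (v i / v j)) :=
    (hasSum_geometric_of_lt_one hr0 hr1).mul_right (v i / v j)
  have hne : (1 - r) ≠ 0 := (sub_pos.2 hr1).ne'
  have hvj : v j ≠ 0 := (hvpos j).ne'
  calc ∑' k, (B ^ k) i j ≤ ∑' k, r ^ k * (v i / v j) :=
        (neumannDom_of_superharmonic hB hvpos hr1 hv i j).tsum_le_tsum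
          (fun k => pow_apply_le_of_superharmonic hB hvpos hr0 hv k i j) hgeo.summable
    _ = (1 - r)⁻¹ * (v i / v j) := hgeo.tsum_eq
    _ = v i / ((1 - r) * v j) := by field_simp

/-- Row-sum certificate: `0 ≤ B` and every row sum `≤ r < 1` ⇒ `B ∈ NeumannDom` (`v = (1,…,1)`). [folklore] -/
theorem neumannDom_of_rowSum_le {B : Matrix n n ℝ} (hB : ∀ i j, 0 ≤ B i j) {r : ℝ} (hr1 : r < 1)
    (h : ∀ i, ∑ j, B i j ≤ r) : NeumannDom B :=
  neumannDom_of_superharmonic hB (v := fun _ => (1 : ℝ)) (fun _ => one_pos) hr1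
    (fun i => by simpa [Matrix.mulVec, dotProduct] using h i)

/-- Column-sum certificate: `0 ≤ B` and every column sum `≤ r < 1` ⇒ `B ∈ NeumannDom`. [folklore] -/
theorem neumannDom_of_colSum_le {B : Matrix n n ℝ} (hB : ∀ i j, 0 ≤ B i j) {r : ℝ} (hr1 : r < 1)
    (h : ∀ j, ∑ i, B i j ≤ r) : NeumannDom B := by
  rw [← neumannDom_transpose_iff]
  exact neumannDom_of_rowSum_le (fun i j => hB j i) hr1 (fun i => by simpa [Matrix.transpose_apply] using h i)

end Superharmonic

end Literature.Probability.FitznerVanDerHofstad2017.EigenTails
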